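import Summits.KontsevichZagierPeriods.Zeta5Search.Barrier.ConeGammaTranslateGradient

/-!
# ζ(5) search — BARRIER: THE FLOW AVERAGE OF THE FIRST MOMENTS IS HALF A PERIOD OF THE JUMP MASSES —
# `(1/T)∫₀ᵀ m_k(δ + τ·s(a)) dτ = (T/2)·J_k(δ)`, exactly

HONEST FRAMING (cell `pub-zeta5`): systematic search; no irrationality claim unless kernel-certified. MODEL objects
under Brown–Zudilin's (28)+(30) accounting ([BZ22] = arXiv:2210.03391; (28) observed, not proved); nothing here is a
statement about `ζ(5)`, any `γ` of record, the cone's supremum (C2 OPEN) or any value at a named direction; NO cancellation is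
quantified; S-E / (TD_A) stay CONJECTURED; records in print UNMOVED. Prover P2 g40 (item «THE SIGNED JUMP MASSES», file (5);
plan INBOX 2026-08-28 l.9814). Source: lead/lit g27 `SE-DESK-NOTE.md` §3(ii), the heuristic «expected size with cancellation
≈ ζ(2)·|S(v)|·ε/2 (conical slope × mean extra shift)» for the within-period drift.

With the objects of files (2b)/(3) at a direction `a` (all forms positive) with period `T` — crossing times
`s_{k,z}(δ) = (z − φ_kδ)/h_k(a)`, jumps `J_{k,z}(δ) = 𝒩(θ_{s_{k,z}}) − 𝒩(θ_{s_{k,z} − r/2})` (`θ_v = v·s(a) + δ`), per-period signed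
jump masses `J_k(δ) = Σ_{z∈S_k(δ)} J_{k,z}` and first moments `m_k(δ) = Σ_{z∈S_k(δ)} s_{k,z}·J_{k,z}` — translating ALONG the orbit,
`δ_τ = δ + τ·s(a)`, shifts every crossing time by `−τ`, keeps every jump (`jump_add_smul_sParam`: the same torus points) and slides
the window `S_k(δ_τ)` of one period along the fixed bi-infinite sequence of crossings (`mem_crossings_shift_iff`:
`z ∈ S_k(δ_τ) ⇔ s_{k,z} − T ≤ τ < s_{k,z}`). Hence, with NO genericity hypothesis at all:
* `firstMoment_shift_eq` — `m_k(δ_τ) = Σ_z [s_{k,z} − T ≤ τ < s_{k,z}]·(s_{k,z} − τ)·J_{k,z}` over the fixed window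
  `z ∈ (⌊φ_kδ⌋, ⌊φ_kδ⌋ + 2T·h_k]` for `0 ≤ τ ≤ T`;
* `integral_indicator_linear_low` / `_high` — `∫₀ᵀ` of one such term is `J·s²/2` (`s ≤ T`) or `J·(T² − (s−T)²)/2` (`T < s ≤ 2T`);
* **`integral_firstMoment_shift` — THE FLOW AVERAGE: `∫₀ᵀ m_k(δ + τ·s(a)) dτ = (T²/2)·J_k(δ)`**: pairing the crossing `z` of the
  period with its copy `z + T·h_k` one period later (`s ↦ s + T`, same jump) the two pieces add up to `T²/2` per crossing;
  `integral_tiltSum_shift` — summed with the tilt weights `φ_kη/(h_k + φ_kη)` of file (3): the phase-averaged drift sum is `T/2`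
  times the jump-mass sum at the tilted rates; `translateIntegral_add_period_smul_sub` — and the next translate is in the chart:
  `P(δ + T·η) − P(δ) = T·Σ_k (φ_kη/h_k)·J_k(δ)` (gradient theorem at `Δ = T·η`).
READING (structure, not a bound). By file (3) the within-period drift of the `n`-th period is `Σ_k (φ_kη/(h_k+φ_kη))·m_k(δ_n)`;
averaged over the PHASE of the closed orbit it is therefore `(T/2)·Σ_k (φ_kη/(h_k+φ_kη))·J_k(δ_n)` — to first order HALF THE
INCREMENT `P(δ_{n+1}) − P(δ_n)` of the static term (file (2b)'s gradient): on phase-average the drift is NOT an independent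
constant but is carried by the translate defects of (TD_A); what is phase-SENSITIVE is only the deviation of `m_k` from its flow
average. This is the kernel form of the desk note's «conical slope × mean extra shift». NOT here (honest): any bound on that
deviation; anything at a named direction; `Φ`, `γ`, C2, S-E's truth, `ζ(5)`.
-/

noncomputable section

open Set MeasureTheory
open scoped Topology

namespace Summit.KontsevichZagierPeriods.Zeta5Search.Barrier.ConeGamma

/-! ### Translating along the orbit: crossing times shift, jumps stay -/

/-- Along the orbit the form `k` of the translate moves linearly: `φ_k(δ + τ·s(a)) = φ_kδ + τ·h_k(a)`. -/
theorem phiForm_add_smul_sParam (a : Dir) (δ : Fin 8 → ℝ) (τ : ℝ) (k : Fin 28) :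
    phiForm (δ + τ • sParam a) k = phiForm δ k + τ * h28 a k := by
  rw [phiForm_add, phiForm_smul_sParam]

/-- The crossing time of `(k, z)` for the translate `δ + τ·s(a)` is `s_{k,z}(δ) − τ`. -/
theorem crossing_add_smul_sParam {a : Dir} (hpos : ∀ k, 0 < h28 a k) (δ : Fin 8 → ℝ) (τ : ℝ) (k : Fin 28) (z : ℤ) :
    ((z : ℝ) - phiForm (δ + τ • sParam a) k) / h28 a k = ((z : ℝ) - phiForm δ k) / h28 a k - τ := by
  rw [phiForm_add_smul_sParam]; field_simp [(hpos k).ne']; ring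

/-- **The jumps travel with the orbit**: the jump of `(k, z)` for the translate `δ + τ·s(a)` (offset `ρ`) equals the jump for
`δ` — both brackets are the SAME two torus points. -/
theorem jump_add_smul_sParam {a : Dir} (hpos : ∀ k, 0 < h28 a k) (δ : Fin 8 → ℝ) (τ ρ : ℝ) (k : Fin 28) (z : ℤ) :
    torusN ((((z : ℝ) - phiForm (δ + τ • sParam a) k) / h28 a k) • sParam a + (δ + τ • sParam a)) -
        torusN ((((z : ℝ) - phiForm (δ + τ • sParam a) k) / h28 a k - ρ) • sParam a + (δ + τ • sParam a)) =
      torusN ((((z : ℝ) - phiForm δ k) / h28 a k) • sParam a + δ) -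
        torusN ((((z : ℝ) - phiForm δ k) / h28 a k - ρ) • sParam a + δ) := by
  rw [crossing_add_smul_sParam hpos]
  have e1 : (((z : ℝ) - phiForm δ k) / h28 a k - τ) • sParam a + (δ + τ • sParam a) =
      (((z : ℝ) - phiForm δ k) / h28 a k) • sParam a + δ := by rw [sub_smul]; abel
  have e2 : (((z : ℝ) - phiForm δ k) / h28 a k - τ - ρ) • sParam a + (δ + τ • sParam a) =
      (((z : ℝ) - phiForm δ k) / h28 a k - ρ) • sParam a + δ := by simp only [sub_smul]; abel
  rw [e1, e2]

/-- **The window of one period slides along the crossings**: for `T·h_k = N ∈ ℤ`,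
`z ∈ S_k(δ + τ·s(a)) = (⌊φ_kδ + τh_k⌋, ⌊φ_kδ + τh_k⌋ + N]  ⇔  s_{k,z}(δ) − T ≤ τ < s_{k,z}(δ)`. -/
theorem mem_crossings_shift_iff {a : Dir} (hpos : ∀ k, 0 < h28 a k) {T : ℝ} (δ : Fin 8 → ℝ) (τ : ℝ) (k : Fin 28)
    {N : ℤ} (hN : T * h28 a k = N) (z : ℤ) :
    z ∈ Finset.Ioc ⌊phiForm δ k + τ * h28 a k⌋ (⌊phiForm δ k + τ * h28 a k⌋ + N) ↔
      ((z : ℝ) - phiForm δ k) / h28 a k - T ≤ τ ∧ τ < ((z : ℝ) - phiForm δ k) / h28 a k := by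
  have hx := hpos k
  rw [Finset.mem_Ioc, Int.floor_lt, ← sub_le_iff_le_add, Int.le_floor, lt_div_iff₀ hx, sub_le_iff_le_add,
    div_le_iff₀ hx]
  push_cast
  constructor
  · rintro ⟨h1, h2⟩; constructor <;> nlinarith
  · rintro ⟨h1, h2⟩; constructor <;> nlinarith

/-- **The first moment of the shifted translate over a FIXED window.** For `0 ≤ τ ≤ T` (`T·h_k = N`):
`m_k(δ + τ·s(a)) = Σ_{z ∈ (⌊φ_kδ⌋, ⌊φ_kδ⌋ + 2N]} [s_{k,z} − T ≤ τ < s_{k,z}]·(s_{k,z} − τ)·J_{k,z}` (all data at `δ`). -/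
theorem firstMoment_shift_eq {a : Dir} (hpos : ∀ k, 0 < h28 a k) {T : ℝ} (δ : Fin 8 → ℝ) (r : ℝ)
    (k : Fin 28) {N : ℤ} (hN : T * h28 a k = N) {τ : ℝ} (hτ0 : 0 ≤ τ) (hτT : τ ≤ T) :
    ∑ z ∈ Finset.Ioc ⌊phiForm (δ + τ • sParam a) k⌋ (⌊phiForm (δ + τ • sParam a) k⌋ + ⌊T * h28 a k⌋),
        ((z : ℝ) - phiForm (δ + τ • sParam a) k) / h28 a k *
          ((torusN ((((z : ℝ) - phiForm (δ + τ • sParam a) k) / h28 a k) • sParam a + (δ + τ • sParam a)) -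
            torusN ((((z : ℝ) - phiForm (δ + τ • sParam a) k) / h28 a k - r / 2) • sParam a +
              (δ + τ • sParam a)) : ℤ) : ℝ) =
      ∑ z ∈ Finset.Ioc ⌊phiForm δ k⌋ (⌊phiForm δ k⌋ + 2 * N),
        if ((z : ℝ) - phiForm δ k) / h28 a k - T ≤ τ ∧ τ < ((z : ℝ) - phiForm δ k) / h28 a k then
          (((z : ℝ) - phiForm δ k) / h28 a k - τ) *
            ((torusN ((((z : ℝ) - phiForm δ k) / h28 a k) • sParam a + δ) -
              torusN ((((z : ℝ) - phiForm δ k) / h28 a k - r / 2) • sParam a + δ) : ℤ) : ℝ)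
        else 0 := by
  have hx := hpos k
  have hNf : ⌊T * h28 a k⌋ = N := by rw [hN, Int.floor_intCast]
  simp_rw [jump_add_smul_sParam hpos, crossing_add_smul_sParam hpos]
  rw [hNf, phiForm_add_smul_sParam]
  -- the shifted window sits inside the fixed double window
  have hsub : Finset.Ioc ⌊phiForm δ k + τ * h28 a k⌋ (⌊phiForm δ k + τ * h28 a k⌋ + N) ⊆
      Finset.Ioc ⌊phiForm δ k⌋ (⌊phiForm δ k⌋ + 2 * N) := by
    intro z hz
    rw [Finset.mem_Ioc] at hz ⊢
    have h1 : ⌊phiForm δ k⌋ ≤ ⌊phiForm δ k + τ * h28 a k⌋ := Int.floor_le_floor (by nlinarith)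
    have h2 : ⌊phiForm δ k + τ * h28 a k⌋ ≤ ⌊phiForm δ k⌋ + N := by
      have : phiForm δ k + τ * h28 a k ≤ phiForm δ k + N := by rw [← hN]; nlinarith
      calc ⌊phiForm δ k + τ * h28 a k⌋ ≤ ⌊phiForm δ k + (N : ℝ)⌋ := Int.floor_le_floor this
        _ = ⌊phiForm δ k⌋ + N := Int.floor_add_intCast _ _
    constructor <;> omega
  rw [← Finset.sum_filter_add_sum_filter_not (Finset.Ioc ⌊phiForm δ k⌋ (⌊phiForm δ k⌋ + 2 * N))
    (fun z => ((z : ℝ) - phiForm δ k) / h28 a k - T ≤ τ ∧ τ < ((z : ℝ) - phiForm δ k) / h28 a k)]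
  rw [Finset.sum_congr rfl (fun z hz => if_pos (Finset.mem_filter.mp hz).2), Finset.sum_congr rfl (fun z hz =>
    if_neg (Finset.mem_filter.mp hz).2), Finset.sum_const_zero, add_zero]
  congr 1
  ext z
  rw [Finset.mem_filter, mem_crossings_shift_iff hpos δ τ k hN]
  constructor
  · intro h; exact ⟨hsub ((mem_crossings_shift_iff hpos δ τ k hN z).mpr h), h⟩
  · exact fun h => h.2

/-! ### The integral of one sliding term -/

/-- `∫₀ᵀ [s − T ≤ τ < s]·(s − τ)·J dτ = J·s²/2` for `0 < s ≤ T`. -/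
theorem integral_indicator_linear_low {T s J : ℝ} (hT : 0 < T) (hs0 : 0 < s) (hsT : s ≤ T) :
    ∫ τ in (0 : ℝ)..T, (if s - T ≤ τ ∧ τ < s then (s - τ) * J else 0) = J * (s ^ 2 / 2) := by
  have heq : (fun τ : ℝ => if s - T ≤ τ ∧ τ < s then (s - τ) * J else 0) =
      (Ico (s - T) s).indicator fun τ => (s - τ) * J := by
    funext τ; simp only [Set.indicator_apply, Set.mem_Ico]
  rw [heq, intervalIntegral.integral_of_le hT.le, setIntegral_indicator measurableSet_Ico,
    show Ioc 0 T ∩ Ico (s - T) s = Ioo 0 s by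
      ext τ; simp only [mem_inter_iff, mem_Ioc, mem_Ico, mem_Ioo]
      constructor
      · rintro ⟨⟨h1, _⟩, _, h4⟩; exact ⟨h1, h4⟩
      · rintro ⟨h1, h2⟩; exact ⟨⟨h1, by linarith⟩, by linarith, h2⟩,
    ← integral_Ioc_eq_integral_Ioo, ← intervalIntegral.integral_of_le hs0.le,
    intervalIntegral.integral_mul_const, intervalIntegral.integral_sub intervalIntegrable_const intervalIntegral.intervalIntegrable_id,
    intervalIntegral.integral_const, integral_id]
  simp; ring

/-- `∫₀ᵀ [s − T ≤ τ < s]·(s − τ)·J dτ = J·(T² − (s − T)²)/2` for `T < s ≤ 2T`. -/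
theorem integral_indicator_linear_high {T s J : ℝ} (hT : 0 < T) (hsT : T < s) (hs2 : s ≤ 2 * T) :
    ∫ τ in (0 : ℝ)..T, (if s - T ≤ τ ∧ τ < s then (s - τ) * J else 0) = J * ((T ^ 2 - (s - T) ^ 2) / 2) := by
  have heq : (fun τ : ℝ => if s - T ≤ τ ∧ τ < s then (s - τ) * J else 0) =
      (Ico (s - T) s).indicator fun τ => (s - τ) * J := by
    funext τ; simp only [Set.indicator_apply, Set.mem_Ico]
  have hle : s - T ≤ T := by linarith
  rw [heq, intervalIntegral.integral_of_le hT.le, setIntegral_indicator measurableSet_Ico,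
    show Ioc 0 T ∩ Ico (s - T) s = Icc (s - T) T by
      ext τ; simp only [mem_inter_iff, mem_Ioc, mem_Ico, mem_Icc]
      constructor
      · rintro ⟨⟨_, h2⟩, h3, _⟩; exact ⟨h3, h2⟩
      · rintro ⟨h1, h2⟩; exact ⟨⟨by linarith, h2⟩, h1, by linarith⟩,
    integral_Icc_eq_integral_Ioc, ← intervalIntegral.integral_of_le hle,
    intervalIntegral.integral_mul_const, intervalIntegral.integral_sub intervalIntegrable_const intervalIntegral.intervalIntegrable_id,
    intervalIntegral.integral_const, integral_id]
  simp; ring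

/-! ### The flow average -/

/-- **THE FLOW AVERAGE OF THE FIRST MOMENTS.** For a direction with all 28 forms positive, `T > 0` a period, ANY translate `δ`,
any offset `r` and any form `k`: `∫₀ᵀ m_k(δ + τ·s(a)) dτ = (T²/2)·J_k(δ)` — averaged over the phase of the orbit, the first
moment of the jumps is half a period times the signed jump mass (no genericity needed: a purely periodic identity). -/
theorem integral_firstMoment_shift {a : Dir} (hpos : ∀ k, 0 < h28 a k) {T : ℝ} (hT : 0 < T)
    (hper : ∀ k : Fin 28, ∃ z : ℤ, T * h28 a k = z) (δ : Fin 8 → ℝ) (r : ℝ) (k : Fin 28) :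
    ∫ τ in (0 : ℝ)..T,
        ∑ z ∈ Finset.Ioc ⌊phiForm (δ + τ • sParam a) k⌋ (⌊phiForm (δ + τ • sParam a) k⌋ + ⌊T * h28 a k⌋),
          ((z : ℝ) - phiForm (δ + τ • sParam a) k) / h28 a k *
            ((torusN ((((z : ℝ) - phiForm (δ + τ • sParam a) k) / h28 a k) • sParam a + (δ + τ • sParam a)) -
              torusN ((((z : ℝ) - phiForm (δ + τ • sParam a) k) / h28 a k - r / 2) • sParam a +
                (δ + τ • sParam a)) : ℤ) : ℝ) =
      T ^ 2 / 2 * ∑ z ∈ Finset.Ioc ⌊phiForm δ k⌋ (⌊phiForm δ k⌋ + ⌊T * h28 a k⌋),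
        ((torusN ((((z : ℝ) - phiForm δ k) / h28 a k) • sParam a + δ) -
          torusN ((((z : ℝ) - phiForm δ k) / h28 a k - r / 2) • sParam a + δ) : ℤ) : ℝ) := by
  obtain ⟨N, hN⟩ := hper k
  have hx := hpos k
  have hNf : ⌊T * h28 a k⌋ = N := by rw [hN, Int.floor_intCast]
  have hN0 : 0 ≤ N := by
    have : (0 : ℝ) ≤ N := by rw [← hN]; positivity
    exact_mod_cast this
  -- abbreviations: crossing time and jump at `δ`
  set c := phiForm δ k with hc
  set s : ℤ → ℝ := fun z => ((z : ℝ) - c) / h28 a k with hs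
  set J : ℤ → ℝ := fun z => ((torusN ((((z : ℝ) - c) / h28 a k) • sParam a + δ) -
    torusN ((((z : ℝ) - c) / h28 a k - r / 2) • sParam a + δ) : ℤ) : ℝ) with hJ
  -- the integrand over the fixed double window
  have hpt : ∀ τ ∈ uIcc (0 : ℝ) T,
      (∑ z ∈ Finset.Ioc ⌊phiForm (δ + τ • sParam a) k⌋ (⌊phiForm (δ + τ • sParam a) k⌋ + ⌊T * h28 a k⌋),
        ((z : ℝ) - phiForm (δ + τ • sParam a) k) / h28 a k *
          ((torusN ((((z : ℝ) - phiForm (δ + τ • sParam a) k) / h28 a k) • sParam a + (δ + τ • sParam a)) -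
            torusN ((((z : ℝ) - phiForm (δ + τ • sParam a) k) / h28 a k - r / 2) • sParam a +
              (δ + τ • sParam a)) : ℤ) : ℝ)) =
      ∑ z ∈ Finset.Ioc ⌊c⌋ (⌊c⌋ + 2 * N), (if s z - T ≤ τ ∧ τ < s z then (s z - τ) * J z else 0) := by
    intro τ hτ
    rw [uIcc_of_le hT.le] at hτ
    exact firstMoment_shift_eq hpos δ r k hN hτ.1 hτ.2
  rw [intervalIntegral.integral_congr hpt, intervalIntegral.integral_finsetSum fun z _ => ?_]
  swap
  · -- integrability of one sliding term: an indicator of an interval times an affine function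
    have heq : (fun τ : ℝ => if s z - T ≤ τ ∧ τ < s z then (s z - τ) * J z else 0) =
        (Ico (s z - T) (s z)).indicator fun τ => (s z - τ) * J z := by
      funext τ; simp only [Set.indicator_apply, Set.mem_Ico]
    rw [heq, intervalIntegrable_iff]
    exact ((intervalIntegrable_iff.mp ((intervalIntegrable_const.sub intervalIntegral.intervalIntegrable_id).mul_const
      (J z)))).indicator measurableSet_Ico
  -- split the double window into the period and its copy
  have hsplit : Finset.Ioc ⌊c⌋ (⌊c⌋ + 2 * N) = Finset.Ioc ⌊c⌋ (⌊c⌋ + N) ∪ Finset.Ioc (⌊c⌋ + N) (⌊c⌋ + 2 * N) := by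
    rw [Finset.Ioc_union_Ioc_eq_Ioc (by omega) (by omega)]
  have hdisj : Disjoint (Finset.Ioc ⌊c⌋ (⌊c⌋ + N)) (Finset.Ioc (⌊c⌋ + N) (⌊c⌋ + 2 * N)) := by
    rw [Finset.disjoint_left]; intro z h1 h2; rw [Finset.mem_Ioc] at h1 h2; omega
  rw [hsplit, Finset.sum_union hdisj, hNf]
  -- re-index the copy by `w = z - N`
  have hshift : ∑ z ∈ Finset.Ioc (⌊c⌋ + N) (⌊c⌋ + 2 * N),
      (∫ τ in (0 : ℝ)..T, if s z - T ≤ τ ∧ τ < s z then (s z - τ) * J z else 0) =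
      ∑ w ∈ Finset.Ioc ⌊c⌋ (⌊c⌋ + N),
        (∫ τ in (0 : ℝ)..T, if s (w + N) - T ≤ τ ∧ τ < s (w + N) then (s (w + N) - τ) * J (w + N) else 0) := by
    rw [show Finset.Ioc (⌊c⌋ + N) (⌊c⌋ + 2 * N) = (Finset.Ioc ⌊c⌋ (⌊c⌋ + N)).map (addRightEmbedding N) by
      rw [Finset.map_add_right_Ioc]; congr 1; ring, Finset.sum_map]
    rfl
  rw [hshift, ← Finset.sum_add_distrib, Finset.mul_sum]
  refine Finset.sum_congr rfl fun w hw => ?_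
  rw [Finset.mem_Ioc] at hw
  -- the copy: crossing time `+ T`, same jump
  have hsN : s (w + N) = s w + T := by
    simp only [hs]; push_cast; rw [← hN]; field_simp; ring
  have hJN : J (w + N) = J w := by
    simp only [hJ]; push_cast
    rw [show ((w : ℝ) + N - c) / h28 a k = ((w : ℝ) - c) / h28 a k + T by rw [← hN]; field_simp; ring,
      show (((w : ℝ) - c) / h28 a k + T) • sParam a + δ = (((w : ℝ) - c) / h28 a k + 1 * T) • sParam a + δ by rw [one_mul],
      show (((w : ℝ) - c) / h28 a k + T - r / 2) • sParam a + δ =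
        (((w : ℝ) - c) / h28 a k - r / 2 + 1 * T) • sParam a + δ by rw [one_mul]; ring_nf]
    have h1 := torusN_line_add_nat_mul_period hper δ (((w : ℝ) - c) / h28 a k) 1
    have h2 := torusN_line_add_nat_mul_period hper δ (((w : ℝ) - c) / h28 a k - r / 2) 1
    push_cast at h1 h2
    rw [h1, h2]
  -- the crossing of the period has `0 < s w ≤ T`
  have hs0 : 0 < s w := by
    simp only [hs]; apply div_pos _ hx; have := (Int.floor_lt.mp hw.1); linarith
  have hsT : s w ≤ T := by
    simp only [hs]; rw [div_le_iff₀ hx, hN]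
    have : ((w - N : ℤ) : ℝ) ≤ c := Int.le_floor.mp (by omega)
    push_cast at this; linarith
  rw [integral_indicator_linear_low hT hs0 hsT, hsN, hJN,
    integral_indicator_linear_high hT (by linarith) (by linarith)]
  simp only [hJ]
  ring


/-- **PHASE-AVERAGED DRIFT.** Summing over the forms with the tilt weights of `ConeGammaTranslateTilt`: for every tilt `η` with
`h_k + φ_kη ≠ 0`, `∫₀ᵀ Σ_k (φ_kη/(h_k + φ_kη))·m_k(δ + τ·s(a)) dτ = (T²/2)·Σ_k (φ_kη/(h_k + φ_kη))·J_k(δ)` — averaged over the phase,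
the first-moment (drift) sum of file (3) is `T/2` times the jump-mass (gradient) sum of file (2b) at the tilted rates. -/
theorem integral_tiltSum_shift {a : Dir} (hpos : ∀ k, 0 < h28 a k) {T : ℝ} (hT : 0 < T)
    (hper : ∀ k : Fin 28, ∃ z : ℤ, T * h28 a k = z) (δ η : Fin 8 → ℝ) (r : ℝ) :
    ∫ τ in (0 : ℝ)..T, ∑ k : Fin 28, phiForm η k / (h28 a k + phiForm η k) *
        ∑ z ∈ Finset.Ioc ⌊phiForm (δ + τ • sParam a) k⌋ (⌊phiForm (δ + τ • sParam a) k⌋ + ⌊T * h28 a k⌋),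
          ((z : ℝ) - phiForm (δ + τ • sParam a) k) / h28 a k *
            ((torusN ((((z : ℝ) - phiForm (δ + τ • sParam a) k) / h28 a k) • sParam a + (δ + τ • sParam a)) -
              torusN ((((z : ℝ) - phiForm (δ + τ • sParam a) k) / h28 a k - r / 2) • sParam a +
                (δ + τ • sParam a)) : ℤ) : ℝ) =
      T ^ 2 / 2 * ∑ k : Fin 28, phiForm η k / (h28 a k + phiForm η k) *
        ∑ z ∈ Finset.Ioc ⌊phiForm δ k⌋ (⌊phiForm δ k⌋ + ⌊T * h28 a k⌋),
          ((torusN ((((z : ℝ) - phiForm δ k) / h28 a k) • sParam a + δ) -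
            torusN ((((z : ℝ) - phiForm δ k) / h28 a k - r / 2) • sParam a + δ) : ℤ) : ℝ) := by
  -- each form separately: the integrand of form `k` is `w_k · m_k(δ_τ)`, integrable as a finite sum of sliding terms
  have hform : ∀ k : Fin 28, IntervalIntegrable (fun τ : ℝ =>
      ∑ z ∈ Finset.Ioc ⌊phiForm (δ + τ • sParam a) k⌋ (⌊phiForm (δ + τ • sParam a) k⌋ + ⌊T * h28 a k⌋),
        ((z : ℝ) - phiForm (δ + τ • sParam a) k) / h28 a k *
          ((torusN ((((z : ℝ) - phiForm (δ + τ • sParam a) k) / h28 a k) • sParam a + (δ + τ • sParam a)) -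
            torusN ((((z : ℝ) - phiForm (δ + τ • sParam a) k) / h28 a k - r / 2) • sParam a +
              (δ + τ • sParam a)) : ℤ) : ℝ)) volume 0 T ∧
      (∫ τ in (0 : ℝ)..T,
        ∑ z ∈ Finset.Ioc ⌊phiForm (δ + τ • sParam a) k⌋ (⌊phiForm (δ + τ • sParam a) k⌋ + ⌊T * h28 a k⌋),
          ((z : ℝ) - phiForm (δ + τ • sParam a) k) / h28 a k *
            ((torusN ((((z : ℝ) - phiForm (δ + τ • sParam a) k) / h28 a k) • sParam a + (δ + τ • sParam a)) -
              torusN ((((z : ℝ) - phiForm (δ + τ • sParam a) k) / h28 a k - r / 2) • sParam a +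
                (δ + τ • sParam a)) : ℤ) : ℝ)) =
        T ^ 2 / 2 * ∑ z ∈ Finset.Ioc ⌊phiForm δ k⌋ (⌊phiForm δ k⌋ + ⌊T * h28 a k⌋),
          ((torusN ((((z : ℝ) - phiForm δ k) / h28 a k) • sParam a + δ) -
            torusN ((((z : ℝ) - phiForm δ k) / h28 a k - r / 2) • sParam a + δ) : ℤ) : ℝ) := by
    intro k
    obtain ⟨N, hN⟩ := hper k
    set c := phiForm δ k with hc
    set s : ℤ → ℝ := fun z => ((z : ℝ) - c) / h28 a k with hs
    set J : ℤ → ℝ := fun z => ((torusN ((((z : ℝ) - c) / h28 a k) • sParam a + δ) -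
      torusN ((((z : ℝ) - c) / h28 a k - r / 2) • sParam a + δ) : ℤ) : ℝ) with hJ
    have hpt : ∀ τ ∈ uIcc (0 : ℝ) T,
        (∑ z ∈ Finset.Ioc ⌊phiForm (δ + τ • sParam a) k⌋ (⌊phiForm (δ + τ • sParam a) k⌋ + ⌊T * h28 a k⌋),
          ((z : ℝ) - phiForm (δ + τ • sParam a) k) / h28 a k *
            ((torusN ((((z : ℝ) - phiForm (δ + τ • sParam a) k) / h28 a k) • sParam a + (δ + τ • sParam a)) -
              torusN ((((z : ℝ) - phiForm (δ + τ • sParam a) k) / h28 a k - r / 2) • sParam a +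
                (δ + τ • sParam a)) : ℤ) : ℝ)) =
        ∑ z ∈ Finset.Ioc ⌊c⌋ (⌊c⌋ + 2 * N), (if s z - T ≤ τ ∧ τ < s z then (s z - τ) * J z else 0) := by
      intro τ hτ
      rw [uIcc_of_le hT.le] at hτ
      exact firstMoment_shift_eq hpos δ r k hN hτ.1 hτ.2
    have hI : IntervalIntegrable (fun τ : ℝ =>
        ∑ z ∈ Finset.Ioc ⌊c⌋ (⌊c⌋ + 2 * N), (if s z - T ≤ τ ∧ τ < s z then (s z - τ) * J z else 0)) volume 0 T := by
      have h := IntervalIntegrable.sum (μ := volume) (a := 0) (b := T) (Finset.Ioc ⌊c⌋ (⌊c⌋ + 2 * N))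
        (f := fun (z : ℤ) (τ : ℝ) => if s z - T ≤ τ ∧ τ < s z then (s z - τ) * J z else 0) fun z _ => by
          have heq : (fun τ : ℝ => if s z - T ≤ τ ∧ τ < s z then (s z - τ) * J z else 0) =
              (Ico (s z - T) (s z)).indicator fun τ => (s z - τ) * J z := by
            funext τ; simp only [Set.indicator_apply, Set.mem_Ico]
          rw [heq, intervalIntegrable_iff]
          exact ((intervalIntegrable_iff.mp ((intervalIntegrable_const.sub intervalIntegral.intervalIntegrable_id).mul_const
            (J z)))).indicator measurableSet_Ico
      refine h.congr fun τ _ => ?_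
      simp only [Finset.sum_apply]
    refine ⟨(hI.congr fun τ hτ => (hpt τ (Set.uIoc_subset_uIcc hτ)).symm), ?_⟩
    exact integral_firstMoment_shift hpos hT hper δ r k
  rw [intervalIntegral.integral_finsetSum fun k _ => (hform k).1.const_mul _, Finset.mul_sum]
  refine Finset.sum_congr rfl fun k _ => ?_
  rw [intervalIntegral.integral_const_mul, (hform k).2]
  ring


/-- **CONSECUTIVE TRANSLATES.** Under the margin hypotheses of the gradient theorem at `δ` and the tilt-size hypothesis
`T·|φ_kη| ≤ r·h_k/4` of file (3), the next translate `δ + T·η` lies in the affine chart: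
`P(δ + T·η) − P(δ) = T·Σ_k (φ_k(η)/h_k(a))·J_k(δ)` — to be read next to `integral_tiltSum_shift`: the phase-averaged drift of the
period is HALF this increment, up to the tilted-rate factors `h_k/(h_k + φ_kη)`. -/
theorem translateIntegral_add_period_smul_sub {a : Dir} (hpos : ∀ k, 0 < h28 a k) {T : ℝ} (hT : 0 < T)
    (hper : ∀ k : Fin 28, ∃ z : ℤ, T * h28 a k = z) {δ : Fin 8 → ℝ} {r : ℝ} (hr : 0 < r)
    (hsep : ∀ (k k' : Fin 28) (z z' : ℤ), (k ≠ k' ∨ z ≠ z') →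
      r ≤ |((z : ℝ) - phiForm δ k) / h28 a k - ((z' : ℝ) - phiForm δ k') / h28 a k'|)
    (hend : ∀ (k : Fin 28) (z : ℤ), r ≤ |((z : ℝ) - phiForm δ k) / h28 a k|)
    {η : Fin 8 → ℝ} (hη : ∀ k, T * |phiForm η k| ≤ r * h28 a k / 4) :
    translateIntegral a T (δ + T • η) - translateIntegral a T δ =
      T * ∑ k : Fin 28, phiForm η k / h28 a k *
        ((∑ z ∈ Finset.Ioc ⌊phiForm δ k⌋ (⌊phiForm δ k⌋ + ⌊T * h28 a k⌋),
          (torusN ((((z : ℝ) - phiForm δ k) / h28 a k) • sParam a + δ) -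
            torusN ((((z : ℝ) - phiForm δ k) / h28 a k - r / 2) • sParam a + δ)) : ℤ) : ℝ) := by
  have hΔ : ∀ k, |phiForm (T • η) k| ≤ r * h28 a k / 4 := fun k => by
    rw [phiForm_smul, abs_mul, abs_of_pos hT]; exact hη k
  rw [translateIntegral_sub_eq_sum_jumpMass hpos hT hper hr hsep hend hΔ, Finset.mul_sum]
  refine Finset.sum_congr rfl fun k _ => ?_
  rw [phiForm_smul]; ring

end Summit.KontsevichZagierPeriods.Zeta5Search.Barrier.ConeGamma

end
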